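import Summits.FinalStateConjecture.FinalStateConjecture.Theorems.EIHFluxBalanceInertialRecessionVirialLemmaC

/-!
# Route EIHFluxBalance — crux `InertialRecession`, abstract endgame for general `N`:
# the pairwise dichotomy from the scale SPLIT

Helper file for the crux `stmt-FinalStateConjecture-10166` (virial route). Mathlib-only. REDUCTION of the line stub
`stub_pairwiseDichotomy` to LEMMA SPLIT: if every pair of bodies is either LINEARLY SEPARATED (`‖ξⱼ − ξᵢ‖ ≥ σt`
eventually) or SUBLINEARLY CONFINED (`‖ξⱼ − ξᵢ‖ = o(t)`), then the stub's dichotomy holds for every pair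
(`pairwiseDichotomy_of_split`): sublinear confinement is an equivalence relation whose classes are linearly isolated
and sublinearly confined, so LEMMA C (`tendsto_velocity_of_isolated_class`) gives one limiting velocity per class.
What remains of `stub_pairwiseDichotomy` after this file is exactly the SPLIT hypothesis `hsplit`.
-/

noncomputable section

open Finset Filter Topology MeasureTheory intervalIntegral

namespace Summit.FinalStateConjecture.FinalStateConjecture.Theorems.SublinearIsFree.Virial

open Literature.Geometry.Lorentzian

variable {N : ℕ}

/-- **The pairwise dichotomy from the scale split** (see the module docstring). [folklore] -/
theorem pairwiseDichotomy_of_split (M : Fin N → ℝ) (ξ v : Fin N → ℝ → E3) (κ : ℝ)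
    (P : ℝ → E3 → ℝ → Fin 4 → ℝ) (hM : ∀ i, 0 < M i) (hκ0 : 0 < κ) (hκ1 : κ < 1)
    (hξ : ∀ i, ContDiff ℝ ((⊤ : ℕ∞) : WithTop ℕ∞) (ξ i))
    (hcone : ∀ i, ∀ᶠ t in atTop, ‖ξ i t‖ ≤ κ ^ 2 * t)
    (hsep : ∀ i j, i ≠ j → Tendsto (fun t ↦ ‖ξ i t - ξ j t‖) atTop atTop) (hvc : ∀ i, Continuous (v i))
    (hk : ∃ k : ℝ, 0 ≤ k ∧ k < 1 ∧ ∀ i t, ‖v i t‖ ≤ k)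
    (hslave : ∀ i, Tendsto (fun t ↦ deriv (ξ i) t - v i t) atTop (𝓝 0))
    (hWL : ∀ ρ : ℝ → ℝ, Tendsto ρ atTop atTop → ∀ δ : ℝ, 0 < δ → δ < 1 → ∃ (C T : ℝ),
      ∀ (t₁ t₂ : ℝ) (c : ℝ → E3) (R : ℝ → ℝ), T ≤ t₁ → t₁ ≤ t₂ →
      (∀ s ∈ Set.Icc t₁ t₂, ∀ s' ∈ Set.Icc t₁ t₂, ‖c s - c s'‖ ≤ 2 * |s - s'| ∧ |R s - R s'| ≤ 2 * |s - s'|) →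
      (∀ s ∈ Set.Icc t₁ t₂, ρ s ≤ δ * R s ∧ ‖c s‖ + R s ≤ (κ + κ ^ 2) / 2 * s ∧
        ∀ j, ‖ξ j s - c s‖ ≤ (1 - δ) * R s ∨ (1 + δ) * R s ≤ ‖ξ j s - c s‖) →
      ∀ μ : Fin 4, |P t₂ (c t₂) (R t₂) μ - P t₁ (c t₁) (R t₁) μ| ≤ C * ∫ s in t₁..t₂, (R s ^ (3 / 2 : ℝ))⁻¹)
    (hID : ∀ ρ : ℝ → ℝ, Tendsto ρ atTop atTop → ∀ δ : ℝ, 0 < δ → δ < 1 → ∃ (T : ℝ) (ζ : ℝ → ℝ),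
      Tendsto ζ atTop (𝓝 0) ∧ ∀ (t : ℝ) (c : E3) (R : ℝ) (A : Finset (Fin N)), T ≤ t → ρ t ≤ δ * R →
      ‖c‖ + R ≤ (κ + κ ^ 2) / 2 * t → (∀ j, ‖ξ j t - c‖ ≤ (1 - δ) * R ∨ (1 + δ) * R ≤ ‖ξ j t - c‖) →
      (∀ j, j ∈ A ↔ ‖ξ j t - c‖ ≤ (1 - δ) * R) →
      |P t c R 0 - ∑ j ∈ A, M j * (√(1 - ‖v j t‖ ^ 2))⁻¹| ≤ ζ t ∧
      ∀ k : Fin 3, |P t c R k.succ - ∑ j ∈ A, M j * (√(1 - ‖v j t‖ ^ 2))⁻¹ * v j t k| ≤ ζ t)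
    (hsplit : ∀ i j : Fin N, (∃ σ : ℝ, 0 < σ ∧ ∀ᶠ t in atTop, σ * t ≤ ‖ξ j t - ξ i t‖) ∨
      ∀ η : ℝ, 0 < η → ∀ᶠ t in atTop, ‖ξ j t - ξ i t‖ ≤ η * t) (i j : Fin N) :
    (∃ σ : ℝ, 0 < σ ∧ ∀ᶠ t in atTop, σ * t ≤ ‖ξ j t - ξ i t‖) ∨
      Tendsto (fun t ↦ v j t - v i t) atTop (𝓝 0) := by
  classical
  rcases hsplit i j with hlin | hconf
  · exact Or.inl hlin
  right
  by_cases hij : i = j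
  · subst hij
    simp
  -- the class of `i`
  set 𝒦 : Finset (Fin N) := univ.filter fun x ↦ ∀ η : ℝ, 0 < η → ∀ᶠ t in atTop, ‖ξ x t - ξ i t‖ ≤ η * t with h𝒦def
  have hmemK : ∀ x, x ∈ 𝒦 ↔ ∀ η : ℝ, 0 < η → ∀ᶠ t in atTop, ‖ξ x t - ξ i t‖ ≤ η * t := fun x ↦ by
    simp [h𝒦def]
  have hi : i ∈ 𝒦 := (hmemK i).mpr fun η hη ↦
    (eventually_ge_atTop 0).mono fun t ht ↦ by rw [sub_self, norm_zero]; positivity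
  have hj : j ∈ 𝒦 := (hmemK j).mpr hconf
  have h2 : 2 ≤ 𝒦.card := Finset.one_lt_card.mpr ⟨i, hi, j, hj, hij⟩
  -- the class is sublinearly confined
  have hconfK : ∀ η : ℝ, 0 < η → ∀ᶠ t in atTop, ∀ x ∈ 𝒦, ∀ y ∈ 𝒦, ‖ξ x t - ξ y t‖ ≤ η * t := by
    intro η hη
    have hall : ∀ᶠ t in atTop, ∀ x ∈ 𝒦, ‖ξ x t - ξ i t‖ ≤ η / 2 * t :=
      (Filter.eventually_all_finset 𝒦).mpr fun x hx ↦ (hmemK x).mp hx (η / 2) (by positivity)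
    filter_upwards [hall] with t ht x hx y hy
    calc ‖ξ x t - ξ y t‖ ≤ ‖ξ x t - ξ i t‖ + ‖ξ i t - ξ y t‖ := norm_sub_le_norm_sub_add_norm_sub _ _ _
      _ ≤ η / 2 * t + η / 2 * t := add_le_add (ht x hx) (by rw [norm_sub_rev]; exact ht y hy)
      _ = η * t := by ring
  -- outsiders are linearly separated from `i`, uniformly
  have hisoz : ∀ z, ∃ σ : ℝ, 0 < σ ∧ (z ∉ 𝒦 → ∀ᶠ t in atTop, σ * t ≤ ‖ξ z t - ξ i t‖) := by
    intro z
    by_cases hz : z ∈ 𝒦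
    · exact ⟨1, one_pos, fun h ↦ absurd hz h⟩
    · rcases hsplit i z with ⟨σ, hσ, h⟩ | h
      · exact ⟨σ, hσ, fun _ ↦ h⟩
      · exact absurd ((hmemK z).mpr h) hz
  choose σf hσf0 hσf using hisoz
  have hune : (univ : Finset (Fin N)).Nonempty := ⟨i, mem_univ _⟩
  set σ₀ : ℝ := univ.inf' hune σf with hσ₀def
  have hσ₀ : 0 < σ₀ := (Finset.lt_inf'_iff hune).mpr fun z _ ↦ hσf0 z
  have hσ₀le : ∀ z, σ₀ ≤ σf z := fun z ↦ Finset.inf'_le σf (mem_univ z)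
  have hiso : ∀ᶠ t in atTop, ∀ x ∈ 𝒦, ∀ z ∉ 𝒦, σ₀ / 2 * t ≤ ‖ξ z t - ξ x t‖ := by
    have hout : ∀ᶠ t in atTop, ∀ z ∈ univ \ 𝒦, σf z * t ≤ ‖ξ z t - ξ i t‖ :=
      (Filter.eventually_all_finset _).mpr fun z hz ↦ hσf z (Finset.mem_sdiff.mp hz).2
    filter_upwards [hout, hconfK (σ₀ / 2) (by positivity), eventually_ge_atTop 0] with t ht hc ht0 x hx z hz
    have h1 := ht z (Finset.mem_sdiff.mpr ⟨mem_univ _, hz⟩)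
    have h2 := hc x hx i hi
    have h3 : σ₀ * t ≤ σf z * t := mul_le_mul_of_nonneg_right (hσ₀le z) ht0
    calc σ₀ / 2 * t ≤ σf z * t - σ₀ / 2 * t := by linarith
      _ ≤ ‖ξ z t - ξ i t‖ - ‖ξ x t - ξ i t‖ := by linarith
      _ ≤ ‖ξ z t - ξ x t‖ := by
          have := norm_sub_le_norm_sub_add_norm_sub (ξ z t) (ξ x t) (ξ i t)
          linarith
  obtain ⟨V, hV⟩ := tendsto_velocity_of_isolated_class M ξ v κ P hM hκ0 hκ1 hξ hcone hsep hvc hk hslave hWL hID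
    𝒦 h2 (half_pos hσ₀) hiso hconfK
  simpa using (hV j hj).sub (hV i hi)

/-- **The pairwise dichotomy from Cesàro velocities.** If every body has a Cesàro velocity `ξᵢ(t)/t → Vᵢ` (the conclusion
of the sibling line's endgame `stub_expandingChargeKinematics`), the scale split holds (`Vᵢ ≠ Vⱼ`: linear separation at rate
`‖Vⱼ − Vᵢ‖/2`; `Vᵢ = Vⱼ`: sublinear confinement), hence — by LEMMA C — the conclusion of `stub_pairwiseDichotomy`: co-moving pairs
have `vⱼ − vᵢ → 0`. [folklore] -/
theorem pairwiseDichotomy_of_cesaro (M : Fin N → ℝ) (ξ v : Fin N → ℝ → E3) (κ : ℝ)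
    (P : ℝ → E3 → ℝ → Fin 4 → ℝ) (hM : ∀ i, 0 < M i) (hκ0 : 0 < κ) (hκ1 : κ < 1)
    (hξ : ∀ i, ContDiff ℝ ((⊤ : ℕ∞) : WithTop ℕ∞) (ξ i))
    (hcone : ∀ i, ∀ᶠ t in atTop, ‖ξ i t‖ ≤ κ ^ 2 * t)
    (hsep : ∀ i j, i ≠ j → Tendsto (fun t ↦ ‖ξ i t - ξ j t‖) atTop atTop) (hvc : ∀ i, Continuous (v i))
    (hk : ∃ k : ℝ, 0 ≤ k ∧ k < 1 ∧ ∀ i t, ‖v i t‖ ≤ k)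
    (hslave : ∀ i, Tendsto (fun t ↦ deriv (ξ i) t - v i t) atTop (𝓝 0))
    (hWL : ∀ ρ : ℝ → ℝ, Tendsto ρ atTop atTop → ∀ δ : ℝ, 0 < δ → δ < 1 → ∃ (C T : ℝ),
      ∀ (t₁ t₂ : ℝ) (c : ℝ → E3) (R : ℝ → ℝ), T ≤ t₁ → t₁ ≤ t₂ →
      (∀ s ∈ Set.Icc t₁ t₂, ∀ s' ∈ Set.Icc t₁ t₂, ‖c s - c s'‖ ≤ 2 * |s - s'| ∧ |R s - R s'| ≤ 2 * |s - s'|) →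
      (∀ s ∈ Set.Icc t₁ t₂, ρ s ≤ δ * R s ∧ ‖c s‖ + R s ≤ (κ + κ ^ 2) / 2 * s ∧
        ∀ j, ‖ξ j s - c s‖ ≤ (1 - δ) * R s ∨ (1 + δ) * R s ≤ ‖ξ j s - c s‖) →
      ∀ μ : Fin 4, |P t₂ (c t₂) (R t₂) μ - P t₁ (c t₁) (R t₁) μ| ≤ C * ∫ s in t₁..t₂, (R s ^ (3 / 2 : ℝ))⁻¹)
    (hID : ∀ ρ : ℝ → ℝ, Tendsto ρ atTop atTop → ∀ δ : ℝ, 0 < δ → δ < 1 → ∃ (T : ℝ) (ζ : ℝ → ℝ),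
      Tendsto ζ atTop (𝓝 0) ∧ ∀ (t : ℝ) (c : E3) (R : ℝ) (A : Finset (Fin N)), T ≤ t → ρ t ≤ δ * R →
      ‖c‖ + R ≤ (κ + κ ^ 2) / 2 * t → (∀ j, ‖ξ j t - c‖ ≤ (1 - δ) * R ∨ (1 + δ) * R ≤ ‖ξ j t - c‖) →
      (∀ j, j ∈ A ↔ ‖ξ j t - c‖ ≤ (1 - δ) * R) →
      |P t c R 0 - ∑ j ∈ A, M j * (√(1 - ‖v j t‖ ^ 2))⁻¹| ≤ ζ t ∧
      ∀ k : Fin 3, |P t c R k.succ - ∑ j ∈ A, M j * (√(1 - ‖v j t‖ ^ 2))⁻¹ * v j t k| ≤ ζ t)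
    (hces : ∀ i : Fin N, ∃ V : E3, Tendsto (fun t : ℝ ↦ t⁻¹ • ξ i t) atTop (𝓝 V)) (i j : Fin N) :
    (∃ σ : ℝ, 0 < σ ∧ ∀ᶠ t in atTop, σ * t ≤ ‖ξ j t - ξ i t‖) ∨
      Tendsto (fun t ↦ v j t - v i t) atTop (𝓝 0) := by
  refine pairwiseDichotomy_of_split M ξ v κ P hM hκ0 hκ1 hξ hcone hsep hvc hk hslave hWL hID (fun a b ↦ ?_) i j
  obtain ⟨Va, hVa⟩ := hces a
  obtain ⟨Vb, hVb⟩ := hces b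
  have hD : Tendsto (fun t : ℝ ↦ t⁻¹ • (ξ b t - ξ a t)) atTop (𝓝 (Vb - Va)) := by
    simpa [smul_sub] using hVb.sub hVa
  by_cases hV : Vb = Va
  · right
    intro η hη
    have h0 : Tendsto (fun t : ℝ ↦ ‖t⁻¹ • (ξ b t - ξ a t)‖) atTop (𝓝 0) := by
      rw [hV, sub_self] at hD
      simpa using hD.norm
    filter_upwards [h0.eventually (gt_mem_nhds hη), eventually_gt_atTop 0] with t ht ht0
    rw [norm_smul, Real.norm_eq_abs, abs_of_pos (inv_pos.mpr ht0)] at ht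
    have h1 := mul_lt_mul_of_pos_left ht ht0
    rw [mul_inv_cancel_left₀ ht0.ne'] at h1
    linarith
  · left
    have hpos : 0 < ‖Vb - Va‖ := norm_pos_iff.mpr (sub_ne_zero.mpr hV)
    refine ⟨‖Vb - Va‖ / 2, by positivity, ?_⟩
    have h0 : ∀ᶠ t in atTop, ‖Vb - Va‖ / 2 < ‖t⁻¹ • (ξ b t - ξ a t)‖ :=
      hD.norm.eventually (lt_mem_nhds (by linarith))
    filter_upwards [h0, eventually_gt_atTop 0] with t ht ht0
    rw [norm_smul, Real.norm_eq_abs, abs_of_pos (inv_pos.mpr ht0)] at ht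
    have h1 := mul_lt_mul_of_pos_left ht ht0
    rw [mul_inv_cancel_left₀ ht0.ne'] at h1
    linarith

/-- Registered one-line form of `pairwiseDichotomy_of_split`. [folklore] -/
theorem pairwiseDichotomy_of_split' : open Literature.Geometry.Lorentzian Filter Topology Finset MeasureTheory intervalIntegral in ∀ {N : ℕ} (M : Fin N → ℝ) (ξ v : Fin N → ℝ → E3) (κ : ℝ) (P : ℝ → E3 → ℝ → Fin 4 → ℝ) (hM : ∀ i, 0 < M i) (hκ0 : 0 < κ) (hκ1 : κ < 1) (hξ : ∀ i, ContDiff ℝ ((⊤ : ℕ∞) : WithTop ℕ∞) (ξ i)) (hcone : ∀ i, ∀ᶠ t in atTop, ‖ξ i t‖ ≤ κ ^ 2 * t) (hsep : ∀ i j, i ≠ j → Tendsto (fun t ↦ ‖ξ i t - ξ j t‖) atTop atTop) (hvc : ∀ i, Continuous (v i)) (hk : ∃ k : ℝ, 0 ≤ k ∧ k < 1 ∧ ∀ i t, ‖v i t‖ ≤ k) (hslave : ∀ i, Tendsto (fun t ↦ deriv (ξ i) t - v i t) atTop (𝓝 0)) (hWL : ∀ ρ : ℝ → ℝ, Tendsto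 ρ atTop atTop → ∀ δ : ℝ, 0 < δ → δ < 1 → ∃ (C T : ℝ), ∀ (t₁ t₂ : ℝ) (c : ℝ → E3) (R : ℝ → ℝ), T ≤ t₁ → t₁ ≤ t₂ → (∀ s ∈ Set.Icc t₁ t₂, ∀ s' ∈ Set.Icc t₁ t₂, ‖c s - c s'‖ ≤ 2 * |s - s'| ∧ |R s - R s'| ≤ 2 * |s - s'|) → (∀ s ∈ Set.Icc t₁ t₂, ρ s ≤ δ * R s ∧ ‖c s‖ + R s ≤ (κ + κ ^ 2) / 2 * s ∧ ∀ j, ‖ξ j s - c s‖ ≤ (1 - δ) * R s ∨ (1 + δ) * R s ≤ ‖ξ j s - c s‖) → ∀ μ : Fin 4, |P t₂ (c t₂) (R t₂) μ - P t₁ (c t₁) (R t₁) μ| ≤ C * ∫ s in t₁..t₂, (R s ^ (3 / 2 : ℝ))⁻¹) (hID : ∀ ρ : ℝ → ℝ, Tendsto ρ atTop atTop → ∀ δ : ℝ, 0 < δ → δ < 1 → ∃ (T : ℝ) (ζ : ℝ → ℝ), Tendsto ζ atTop (𝓝 0) ∧ ∀ (t : ℝ) (c : E3) (R : ℝ) (A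 : Finset (Fin N)), T ≤ t → ρ t ≤ δ * R → ‖c‖ + R ≤ (κ + κ ^ 2) / 2 * t → (∀ j, ‖ξ j t - c‖ ≤ (1 - δ) * R ∨ (1 + δ) * R ≤ ‖ξ j t - c‖) → (∀ j, j ∈ A ↔ ‖ξ j t - c‖ ≤ (1 - δ) * R) → |P t c R 0 - ∑ j ∈ A, M j * (√(1 - ‖v j t‖ ^ 2))⁻¹| ≤ ζ t ∧ ∀ k : Fin 3, |P t c R k.succ - ∑ j ∈ A, M j * (√(1 - ‖v j t‖ ^ 2))⁻¹ * v j t k| ≤ ζ t) (hsplit : ∀ i j : Fin N, (∃ σ : ℝ, 0 < σ ∧ ∀ᶠ t in atTop, σ * t ≤ ‖ξ j t - ξ i t‖) ∨ ∀ η : ℝ, 0 < η → ∀ᶠ t in atTop, ‖ξ j t - ξ i t‖ ≤ η * t) (i j : Fin N), (∃ σ : ℝ, 0 < σ ∧ ∀ᶠ t in atTop, σ * t ≤ ‖ξ j t - ξ i t‖) ∨ Tendsto (fun t ↦ v j t - v i t) atTop (𝓝 0) :=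
  fun M ξ v κ P hM hκ0 hκ1 hξ hcone hsep hvc hk hslave hWL hID hsplit i j ↦
    pairwiseDichotomy_of_split M ξ v κ P hM hκ0 hκ1 hξ hcone hsep hvc hk hslave hWL hID hsplit i j

end Summit.FinalStateConjecture.FinalStateConjecture.Theorems.SublinearIsFree.Virial

end
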